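import Literature.MathematicalPhysics.QuantumFieldTheory.Balaban1983to89.B9Thm34GpKernelFinal

/-!
# `Balaban1983to89.B9Thm34PKernelFinal` — [Balaban1985BackgroundPropagators] THEOREM 3.4 p. 400 / p. 403, THE `R(U)`-CLAUSE: (3.49) FOR `P(U′U)` IN
# THE PRINTED KERNEL FORM `[|P(x,x′)|, |(∇P)(x,x′)|, |(P∇*)(x,x′)|, |(∇P∇*)(x,x′)|] ≦ K[1, (Lʲη)⁻¹, (Lʲη)⁻¹, (Lʲη)⁻²](L^{j′}η)^{−d}e^{−(δ₀/5)d(y,y′)}`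
# for `P(U′U) = G′(U′U)Q′*(U′U)C⁻¹(U′U)Q′(U′U)G′(U′U)` — FILE 30 of the Sect. B programme of cell `lit-balaban`, seat r06 (B9 fold owner) gen 15: the
# kernel-form twin of FILE 27 (`B9Thm34RFinal`, (3.49) for `P(U′U)` as block majorants)

statement-level skeleton of published theorems with citation tags; proofs where landed; nothing here is a claim about the Yang–Mills mass gap

DOCFIX (cell `lit-balaban`, seat r06 gen 23, 2026-08-23, DOC-ONLY; owner re-read of the page render p. 399 [PDF 11] `b2b-balaban-ref1/pages/1985-cmp99-background-propagators/…-p011-x2.png`): the quotation of (3.49) carried the rate «e^{−δ₀d(y,y′)}»; print has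
«e^{−(1/2)δ₀d(y,y′)}» — corrected in the CITATION HEADER and the docstring of `thm34_P_kernel_final` (2 place(s)); declarations, statements and proofs byte-identical to the tree copy.

CITATION HEADER (lean-in-tree rule).  B9 = T. Bałaban, *Propagators for lattice gauge theories in a background field*, Commun. Math. Phys. **99** (1985)
389–434 [Balaban1985BackgroundPropagators] (held `paper:balaban1985-cmp99-background-propagators`, journal page = PDF page + 388; text layer re-read by
this seat 2026-08-22).  Theorem 3.4 p. 400 [PDF 12, L7–10] «There exists a positive constant a₁ such that the operators G′(U), (Q′(U)G′²(U)Q′*(U))⁻¹,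
R(U), G(U) extend to configurations U′U for α₁ ≦ a₁ as analytic functions of A. The extended operators satisfy all the inequalities of Theorems
3.1–3.3 correspondingly.»; (3.49) p. 399 [PDF 11, L5–9] «For the operator P = I − R we obtain, using again Lemma 2.1, [|P(x,x′)|, |(DP)_μ(x,x′)|,
|(PD*)_ν(x,x′)|, |(DPD*)_{μν}(x,x′)|] ≦ O(1)[1, (Lʲη)⁻¹, (Lʲη)⁻¹, (Lʲη)⁻²](L^{j′}η)^{−d}e^{−(1/2)δ₀d(y,y′)} for x ∈ Δ(y), y ∈ Λ_j, x′ ∈ Δ(y′), y′ ∈ Λ_{j′}»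
(the printed KERNEL shape = `B6RandomWalkKernel.HasKernelBound`, kernels for the pairing of p. 393, block volume weight `v(y′) = (L^{j′}η)^d`); p. 403
[PDF 15] «the operators R(U), P(U) = I − R(U) extend analytically to the domain (3.37) and satisfy the same bounds, e.g. the operator P(U′U) satisfies
the bounds (3.49)»; (3.25) p. 394 «P(U) = G′Q′*(Q′G′²Q′*)⁻¹Q′G′»; Theorem 3.1 (3.42) p. 397, Theorem 3.2 (3.48) p. 398, the p. 398 scale-transfer
remark, (3.19) p. 393, (3.57)–(3.67) pp. 401–403, (3.37) p. 396.  [4] = [Balaban1984PropagatorsII] T. Bałaban, *Propagators and renormalization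
transformations for lattice gauge theories. II*, Commun. Math. Phys. **96** (1984) 223–250: (2.51)–(2.55) p. 232, Lemma 2.1 p. 234, (2.66) p. 234,
(2.68) p. 235.  Rows B9.Eq3.49 × B9.Thm3.4 × B9.Eq3.25 (cells only; no head change).

WHAT IS PROVED (theorems only: 0 `def`, 0 sorry, 0 named facts; standard axioms).  **`thm34_P_kernel_final`** — hypotheses = FILE 27's
`B9Thm34RFinal.thm34_R_final` VERBATIM (Theorem 3.1 (3.42)₁₋₃ for `G′(U)` as block majorants, Theorem 3.2 for `U` ((3.21) `hLinv`, (3.48) `h348`), the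
(3.19) letters `Q′(U)`, `Q′*(U)` with a section `rep` of the block map, [4] Lemma 2.1 at `δ₀` for every exponent, the p. 398 scale transfer, the
`A`-free (3.60) data) PLUS the letter `Δ′_a(U)` with `G′(U)` its two-sided inverse (FILE 26) PLUS Theorem 3.1's (3.42)₁₋₄ for `G′(U)` as KERNEL bounds
(FILE 29); conclusion: `∃ a₁ > 0 ∃ K ≧ 0 ∀ α₁ ≦ a₁ ∀ A` in (3.37) (blockwise) `∀ kF sF ∀` (3.57)/(3.59) letters `Q′(U′U) = Q′ + F′₂`, `Q′*(U′U) = Q′* + F′₂*`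
(block-local, size `c_Fα₁`): THERE EXISTS `C⁻¹(U′U)`, two-sided inverse of `Q′(U′U)G′²(U′U)Q′*(U′U)` on 𝔅 (`G′(U′U) = gPrimeExtEnd G′ (V′G′)`), such
that `P(U′U) = B9Eq360Vprime.pOp G′(U′U) Q′*(U′U) C⁻¹(U′U) Q′(U′U)` (read on the sites through `rep`, as in FILE 27) has the PRINTED KERNEL BOUNDS
`|P(U′U)(x,x′)| ≦ Ke^{−(δ₀/5)d}v(y′)⁻¹`, `|(∇_kP(U′U))(x,x′)|, |(P(U′U)∇*_l)(x,x′)| ≦ K(Lʲη)⁻¹e^{−(δ₀/5)d}v⁻¹`, `|(∇_kP(U′U)∇*_l)(x,x′)| ≦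
K(Lʲη)⁻²e^{−(δ₀/5)d}v⁻¹` — ONE `K`, independent of `α₁` and `A`.  PROOF («using again Lemma 2.1», p. 399; «satisfy the same bounds», p. 403):
`C⁻¹(U′U)` with its (3.48) kernel bound from FILE 26 (`thm34_Cinv_final`), read as a block majorant on 𝔅 (`B6RandomWalkSection.hasMajorant_id_of_ker`);
the block majorants of `X·G′(U′U)` from FILE 26 (`thm34_Gp_final`); the prefix word `X·G′(U′U)·Q′*(U′U)·C⁻¹(U′U)·Q′(U′U)` by gen 11's two-space word
calculus `B9Ineq349Hom.hasMajorantHom_word349` ([4] (2.52)–(2.55) + the y″-sum of (2.68)); the right letter `G′(U′U)·Y` in KERNEL form from FILE 29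
(`thm34_Gp_kernel_final`); majorant × kernel ⇒ kernel (`B9Ineq385Kernel.hasKernelBound_comp_decay`, the factor `(L^{j′}η)^{−d}` riding on the right
letter); rates `9δ₀/25` (letters) → `δ₀/4` (prefix) → `δ₀/5` (kernel), exponents `1/100`.

HONEST SCOPE / NOT CLAIMED.  (i) As in FILES 20–29: Theorems 3.1/3.2 FOR `U` are the INPUTS — the file certifies the implication «Thms 3.1–3.2 for U ⇒
(3.49) for P(U′U)», not (3.49) for a general background (row B9.Eq3.49 head unchanged); (ii) (3.68)'s `P′(A) = P(U′U) − P(U)` with the factor `α₁`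
is NOT given in kernel form here (it needs FILE 27's five-word telescoping in kernel form; FILE 27 has it as block majorants); (iii) the letters `∇`,
`∇*` are the single-direction difference letters `conj b (diffLetter η⁻¹ k)` of (3.42)'s kernel hypotheses (FILES 25/29), not FILE 27's two-space
gradient `conjHom b (gradLin …)` (INTERFACES-r06 «two vocabularies» note); (iv) the rate `δ₀/5` and the exponents `1/100` are ONE admissible
bookkeeping of «the same bounds» (p. 403); (v) `a₁`, `K` packaged existentially after the lattice is fixed (values depend on `d, L, δ₀, B_G, B₁, κ_Q,
c_F` and the scale-transfer constants only); (vi) the Hölder remark after (3.49) is not treated.  NOT summit progress.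

RELATED IN THE TREE, NOT DUPLICATED (searched 2026-08-22: `lean search 'P_kernel_final|pOp_kernel' --decl` = ∅): FILE 27 `B9Thm34RFinal.thm34_R_final`
((3.49)/(3.68) as block majorants), FILE 26 `B9Thm34SectBFinal.thm34_Gp_final`/`thm34_Cinv_final`, FILE 29 `B9Thm34GpKernelFinal.thm34_Gp_kernel_final`,
gen 11 `B9Ineq349Hom.hasMajorantHom_word349`, FILE 22 `B9Ineq385Kernel.hasKernelBound_comp_decay`, FILE 17 `B6RandomWalkSection` (`secExt`, `secRes`,
`secConj`, `hasMajorant_id_of_ker`) — all USED BY NAME.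
-/

noncomputable section

namespace Literature.MathematicalPhysics.QuantumFieldTheory.Balaban1983to89.B9Thm34PKernelFinal

open NormedSpace Complex
open Literature.MathematicalPhysics.QuantumFieldTheory.Balaban1983to89
open Literature.MathematicalPhysics.QuantumFieldTheory.Balaban1983to89.B6RandomWalk (HasMajorant hasMajorant_mono Triangle254 Ineq261)
open Literature.MathematicalPhysics.QuantumFieldTheory.Balaban1983to89.B6RandomWalkHom (HasMajorantHom hasMajorantHom_mono hasMajorantHom_iff
  hasMajorantHom_add)
open Literature.MathematicalPhysics.QuantumFieldTheory.Balaban1983to89.B6RandomWalkKernel (HasKernelBound hasKernelBound_mono)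
open Literature.MathematicalPhysics.QuantumFieldTheory.Balaban1983to89.B9Thm34Ext (toB6)
open Literature.MathematicalPhysics.QuantumFieldTheory.Balaban1983to89.B9Ineq347 (ScaleTransfer)
open Literature.MathematicalPhysics.QuantumFieldTheory.Balaban1983to89.B9Eq39Adjoint (covD covDstar)
open Literature.MathematicalPhysics.QuantumFieldTheory.Balaban1983to89.B9Eq352DivForm (tauB)
open Literature.MathematicalPhysics.QuantumFieldTheory.Balaban1983to89.B9Eq352DivFormLetters (conj)
open Literature.MathematicalPhysics.QuantumFieldTheory.Balaban1983to89.B9Eq352GradLetters (diffLetter)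
open Literature.MathematicalPhysics.QuantumFieldTheory.Balaban1983to89.B9Eq360Vprime (gPrimeExtEnd)
open Literature.MathematicalPhysics.QuantumFieldTheory.Balaban1983to89.B9Eq360VprimeLetters (vPrimeConc)
open Literature.MathematicalPhysics.QuantumFieldTheory.Balaban1983to89.B6RandomWalkSection (secExt secRes secConj secConj_def secRes_secExt_apply
  hasMajorant_id_of_ker)
open Literature.MathematicalPhysics.QuantumFieldTheory.Balaban1983to89.B9Ineq349Hom (hasMajorantHom_rate_mono hasMajorantHom_word349)
open Literature.MathematicalPhysics.QuantumFieldTheory.Balaban1983to89.B9Ineq385Kernel (hasKernelBound_rate_mono hasKernelBound_comp_decay)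
open Literature.MathematicalPhysics.QuantumFieldTheory.Balaban1983to89.B9Thm34SectBFinal (thm34_Gp_final thm34_Cinv_final)
open Literature.MathematicalPhysics.QuantumFieldTheory.Balaban1983to89.B9Thm34GpKernelFinal (thm34_Gp_kernel_final)

section Final

variable {𝔸 : Type*} [NormedRing 𝔸] [NormedAlgebra ℂ 𝔸] [CompleteSpace 𝔸] {ι : Type} [Fintype ι]
variable (b : Module.Basis ι ℝ 𝔸) {S : Type} {κ : Type} [Fintype κ]
variable (T : κ → Equiv.Perm S) (U : κ → S → 𝔸ˣ)
variable {g : B9.Geometry} [Fintype g.Site] {Rr : ℝ} {H : Prop}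

set_option maxHeartbeats 1600000 in
/-- **THEOREM 3.4, `R(U)`-CLAUSE: (3.49) FOR `P(U′U)` IN THE PRINTED KERNEL FORM, PRINTED QUANTIFIERS** — p. 403 «the operators R(U), P(U) = I − R(U)
extend analytically to the domain (3.37) and satisfy the same bounds, e.g. the operator P(U′U) satisfies the bounds (3.49)», (3.49) p. 399 «[|P(x,x′)|,
|(DP)_μ(x,x′)|, |(PD*)_ν(x,x′)|, |(DPD*)_{μν}(x,x′)|] ≦ O(1)[1, (Lʲη)⁻¹, (Lʲη)⁻¹, (Lʲη)⁻²](L^{j′}η)^{−d}e^{−(1/2)δ₀d(y,y′)} for x ∈ Δ(y), x′ ∈ Δ(y′)»: given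
Theorem 3.1 for `G′(U)` ((3.26) two-sided inverse of the letter `Δ′_a(U)`; (3.42)₁₋₃ as block majorants and (3.42)₁₋₄ as kernel bounds at the rate
`δ₀`) and Theorem 3.2 for `U` ((3.21) `hLinv`, (3.48) kernel bound `B₁`), [4] Lemma 2.1 and the p. 398 scale transfer for every exponent, the (3.19)
letters with a section `rep` of the block map, the `A`-free (3.60) data: `∃ a₁ > 0 ∃ K ≧ 0 ∀ α₁ ∈ [0, a₁] ∀ A` in (3.37) (blockwise) `∀ kF sF ∀`
(3.57)/(3.59) letters: THERE EXISTS `C⁻¹(U′U)` (two-sided inverse of `Q′(U′U)G′²(U′U)Q′*(U′U)`) such that `P(U′U) = pOp G′(U′U) Q′*(U′U) C⁻¹(U′U)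
Q′(U′U)` has the kernel bounds `|P(U′U)(x,x′)| ≦ Ke^{−(δ₀/5)d(y,y′)}v(y′)⁻¹`, `|(∇_kP(U′U))(x,x′)|, |(P(U′U)∇*_l)(x,x′)| ≦ K(Lʲη)⁻¹e^{−(δ₀/5)d}v(y′)⁻¹`,
`|(∇_kP(U′U)∇*_l)(x,x′)| ≦ K(Lʲη)⁻²e^{−(δ₀/5)d}v(y′)⁻¹` — ONE `K`, independent of `α₁` and `A`.
[cite: Balaban1985BackgroundPropagators, Thm 3.4 p.400 + (3.49) p.399 + p.403 + (3.25) p.394 + Thm 3.1 (3.42) p.397 + Thm 3.2 (3.48) p.398 + p.398 remark + (3.19)/(3.21) pp.393–394 + (3.57)–(3.67) pp.401–403 + (3.37) p.396; Balaban1984PropagatorsII, Lemma 2.1 p.234 + (2.51)–(2.55) p.232 + (2.66) p.234 + (2.68) p.235] -/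

theorem thm34_P_kernel_final [Fintype S] [DecidableEq S] [DecidableEq ι] [DecidableEq g.Site] [Nonempty g.Site] (blk : S → g.Site) (d : ℕ)
    (δ₀ κQ BG B₁ cF Cq a₀ d₀ M₂ : ℝ)
    (kQ : g.Site → S → 𝔸 →L[ℝ] 𝔸) (sQ : S → 𝔸 →L[ℝ] 𝔸) (cfun w : g.Site → ℝ)
    (hκQ : 0 < κQ) (hBG : 0 < BG) (hB₁ : 0 < B₁) (hcF : 0 < cF) (hCq : 0 ≤ Cq) (ha₀ : 0 ≤ a₀) (hM₂ : 0 ≤ M₂) (hδ₀ : 0 < δ₀)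
    -- the multiscale geometry 𝔅 and its axioms
    (hdnn : ∀ a a' : g.Site, 0 ≤ g.dist a a') (htri : Triangle254 (toB6 g Rr H)) (hrefl : ∀ y : g.Site, g.dist y y = 0)
    (hsym : ∀ y y' : g.Site, g.dist y y' = g.dist y' y) (hlen : ∀ y : g.Site, 0 < g.len y) (hlenη : ∀ y : g.Site, g.eta ≤ g.len y)
    (hη : 0 < g.eta)
    -- [4] Lemma 2.1 (2.61) at the rate `δ₀`, «for every 0 < α < 1», and the p. 398 scale transfer for every exponent
    (h261 : ∀ α : ℝ, 0 < α → α < 1 → Ineq261 d (toB6 g Rr H) δ₀ α)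
    (hST : ∀ α : ℝ, 0 < α → ∃ Λ : ℝ, 1 ≤ Λ ∧ ScaleTransfer g δ₀ α Λ (fun a => g.len a) ∧ ScaleTransfer g δ₀ α Λ (fun a => g.len a ^ 2) ∧
      ScaleTransfer g δ₀ α Λ (fun a => (g.len a)⁻¹) ∧ ScaleTransfer g δ₀ α Λ (fun a => (g.len a ^ 2)⁻¹) ∧
      ScaleTransfer g δ₀ α Λ (fun a => (g.len a ^ 4)⁻¹) ∧ ScaleTransfer g δ₀ α Λ (fun y => g.len y ^ (-(4 : ℝ))))
    (hrepr : ∀ (v : 𝔸) (i : ι), |b.repr v i| ≤ M₂ * ‖v‖)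
    (hU1 : ∀ m z, ‖((U m z : 𝔸ˣ) : 𝔸)‖ ≤ 1 ∧ ‖(((U m z)⁻¹ : 𝔸ˣ) : 𝔸)‖ ≤ 1)
    (hd₀B : ∀ μ x, g.dist (blk x) (blk ((T μ).symm x)) ≤ d₀) (hd₀F : ∀ μ x, g.dist (blk x) (blk (T μ x)) ≤ d₀)
    (hd₀0 : ∀ y : g.Site, g.dist y y ≤ d₀)
    -- the `A`-independent data of the concrete `V′(A)` of (3.60)
    (hw : ∀ y, 0 ≤ w y) (hcard : ∀ y, ((B9Eq360Vprime.block blk y).card : ℝ) * w y ≤ 1)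
    (hkQ : ∀ y x, blk x = y → ‖kQ y x‖ ≤ w y) (hsQ : ∀ x, ‖sQ x‖ ≤ 1) (hcfun : ∀ y, |cfun y| ≤ a₀ * (g.len y ^ 2)⁻¹)
    -- THEOREM 3.1 for `G′(U)`: (3.42)₁,₂,₃ at the rate `δ₀`
    {Gp : Module.End ℝ (S × ι → ℝ)}
    (h342_1 : HasMajorant (g := toB6 g Rr H) (fun p : S × ι => blk p.1) Gp
      (fun a a' => BG * g.len a ^ 2 * Real.exp (-(δ₀ * g.dist a a'))))
    (h342_2 : ∀ k : κ ⊕ κ, HasMajorant (g := toB6 g Rr H) (fun p : S × ι => blk p.1)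
      (conj b (diffLetter T U ((g.eta : ℂ)⁻¹) k) * Gp) (fun a a' => BG * g.len a * Real.exp (-(δ₀ * g.dist a a'))))
    (h342_3 : ∀ k : κ ⊕ κ, HasMajorant (g := toB6 g Rr H) (fun p : S × ι => blk p.1)
      (Gp * conj b (diffLetter T U ((g.eta : ℂ)⁻¹) k)) (fun a a' => BG * g.len a * Real.exp (-(δ₀ * g.dist a a'))))
    -- the (3.19) letters `Q′(U)`, `Q′*(U)` in their own typing with block-local two-space majorants, a section of the block map (FILE 17)
    (rep : g.Site → S × ι) (hrep : ∀ y : g.Site, blk (rep y).1 = y)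
    {Qc : (S × ι → ℝ) →ₗ[ℝ] (g.Site → ℝ)} {Qcs : (g.Site → ℝ) →ₗ[ℝ] (S × ι → ℝ)} {Linv : Module.End ℝ (g.Site → ℝ)}
    (hQc : HasMajorantHom (g := toB6 g Rr H) (fun p : S × ι => blk p.1) (fun y : g.Site => y) Qc
      (fun a a' : g.Site => κQ * (if a = a' then (1 : ℝ) else 0)))
    (hQcs : HasMajorantHom (g := toB6 g Rr H) (fun y : g.Site => y) (fun p : S × ι => blk p.1) Qcs
      (fun a a' : g.Site => κQ * (if a = a' then (1 : ℝ) else 0)))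
    -- THEOREM 3.2 for `U`: (3.21) `C⁻¹ = (Q′G′²Q′*)⁻¹` exists (`hLinv`) with the KERNEL bound (3.48) at the rate `δ₀`
    (hLinv : (Qc ∘ₗ (Gp * Gp) ∘ₗ Qcs) * Linv = 1)
    (h348 : ∀ y y' : g.Site, |B9Thm34Inv.ker (B9Thm34Inv.vol g d) Linv y y'| ≤
      B₁ * g.len y ^ (-(4 : ℝ)) * g.len y' ^ (-(d : ℝ)) * Real.exp (-(δ₀ * g.dist y y')))
    -- THEOREM 3.1 for `G′(U)`: the letter `Δ′_a(U)` with `G′(U)` its two-sided inverse ((3.26); FILE 26)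
    {Δp : Module.End ℝ (S × ι → ℝ)} (hΔpGp : Δp * Gp = 1) (hGpΔp : Gp * Δp = 1)
    -- the kernel pairing of p. 393 (`c = η^d`, block volume weight `v(y′) = (L^{j′}η)^d`) and THEOREM 3.1's (3.42)₁₋₄ FOR `G′(U)` IN THE PRINTED KERNEL FORM
    {v : g.Site → ℝ} (hv : ∀ y, 0 < v y) {cK : ℝ} (hcK : 0 < cK)
    (hGpk : HasKernelBound (g := toB6 g Rr H) (fun p : S × ι => blk p.1) v cK Gp
      (fun a a' => BG * g.len a ^ 2 * Real.exp (-(δ₀ * g.dist a a'))))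
    (hDGpk : ∀ k : κ ⊕ κ, HasKernelBound (g := toB6 g Rr H) (fun p : S × ι => blk p.1) v cK
      (conj b (diffLetter T U ((g.eta : ℂ)⁻¹) k) * Gp) (fun a a' => BG * g.len a * Real.exp (-(δ₀ * g.dist a a'))))
    (hGpDk : ∀ l : κ ⊕ κ, HasKernelBound (g := toB6 g Rr H) (fun p : S × ι => blk p.1) v cK
      (Gp * conj b (diffLetter T U ((g.eta : ℂ)⁻¹) l)) (fun a a' => BG * g.len a * Real.exp (-(δ₀ * g.dist a a'))))
    (hDGpDk : ∀ k l : κ ⊕ κ, HasKernelBound (g := toB6 g Rr H) (fun p : S × ι => blk p.1) v cK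
      (conj b (diffLetter T U ((g.eta : ℂ)⁻¹) k) * Gp * conj b (diffLetter T U ((g.eta : ℂ)⁻¹) l)) (fun a a' => BG * Real.exp (-(δ₀ * g.dist a a')))) :
    ∃ a₁ : ℝ, 0 < a₁ ∧ ∃ K : ℝ, 0 ≤ K ∧
    ∀ (α₁ : ℝ), 0 ≤ α₁ → α₁ ≤ a₁ →
    -- the exponent field `A` in the domain (3.37), read blockwise, and the `A`-dependent (3.59) data `kF`, `sF`
    ∀ (A : κ → S → 𝔸) (kF : g.Site → S → 𝔸 →L[ℝ] 𝔸) (sF : S → 𝔸 →L[ℝ] 𝔸),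
      (∀ y x, blk x = y → ‖kF y x‖ ≤ Cq * α₁ * w y) → (∀ x, ‖sF x‖ ≤ Cq * α₁) →
      (∀ ν k x, ‖((g.eta : ℂ)⁻¹) • covDstar T U ν (A k) x‖ ≤ α₁ * (g.len (blk x) ^ 2)⁻¹) →
      (∀ μ ν x, ‖((g.eta : ℂ)⁻¹) • covD T U μ (A ν) x‖ ≤ α₁ * (g.len (blk x) ^ 2)⁻¹) →
      (∀ μ x, ‖((g.eta : ℂ)⁻¹) • covDstar T U μ (tauB T U μ (A μ)) x‖ ≤ α₁ * (g.len (blk x) ^ 2)⁻¹) →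
      (∀ k x, ‖A k x‖ ≤ α₁ * (g.len (blk x))⁻¹) → (∀ ν k x, ‖tauB T U ν (A k) x‖ ≤ α₁ * (g.len (blk x))⁻¹) →
    -- the (3.57)/(3.59) letters `F′₂(A)`, `F′₂*(A)` (block-local, size `c_F α₁`)
    ∀ {Qc' Fc : (S × ι → ℝ) →ₗ[ℝ] (g.Site → ℝ)} {Qcs' Fcs : (g.Site → ℝ) →ₗ[ℝ] (S × ι → ℝ)},
      Qc' = Qc + Fc → Qcs' = Qcs + Fcs →
      HasMajorantHom (g := toB6 g Rr H) (fun p : S × ι => blk p.1) (fun y : g.Site => y) Fc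
        (fun a a' : g.Site => cF * α₁ * (if a = a' then (1 : ℝ) else 0)) →
      HasMajorantHom (g := toB6 g Rr H) (fun y : g.Site => y) (fun p : S × ι => blk p.1) Fcs
        (fun a a' : g.Site => cF * α₁ * (if a = a' then (1 : ℝ) else 0)) →
    ∃ Tinv : Module.End ℝ (g.Site → ℝ),
      Tinv * (Qc' ∘ₗ ((gPrimeExtEnd Gp (conj b (vPrimeConc T U g.eta A blk kQ kF sQ sF cfun) * Gp)) * (gPrimeExtEnd Gp (conj b (vPrimeConc T U g.eta A blk kQ kF sQ sF cfun) * Gp))) ∘ₗ Qcs') = 1 ∧ (Qc' ∘ₗ ((gPrimeExtEnd Gp (conj b (vPrimeConc T U g.eta A blk kQ kF sQ sF cfun) * Gp)) * (gPrimeExtEnd Gp (conj b (vPrimeConc T U g.eta A blk kQ kF sQ sF cfun) * Gp))) ∘ₗ Qcs') * Tinv = 1 ∧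
      HasKernelBound (g := toB6 g Rr H) (fun p : S × ι => blk p.1) v cK (B9Eq360Vprime.pOp (gPrimeExtEnd Gp (conj b (vPrimeConc T U g.eta A blk kQ kF sQ sF cfun) * Gp)) (Qcs' ∘ₗ secRes rep) (secConj rep Tinv) (secExt rep ∘ₗ Qc'))
        (fun a a' => K * Real.exp (-(1 / 5 * δ₀ * g.dist a a'))) ∧
      (∀ k : κ ⊕ κ, HasKernelBound (g := toB6 g Rr H) (fun p : S × ι => blk p.1) v cK (conj b (diffLetter T U ((g.eta : ℂ)⁻¹) k) * (B9Eq360Vprime.pOp (gPrimeExtEnd Gp (conj b (vPrimeConc T U g.eta A blk kQ kF sQ sF cfun) * Gp)) (Qcs' ∘ₗ secRes rep) (secConj rep Tinv) (secExt rep ∘ₗ Qc')))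
        (fun a a' => K * (g.len a)⁻¹ * Real.exp (-(1 / 5 * δ₀ * g.dist a a')))) ∧
      (∀ l : κ ⊕ κ, HasKernelBound (g := toB6 g Rr H) (fun p : S × ι => blk p.1) v cK ((B9Eq360Vprime.pOp (gPrimeExtEnd Gp (conj b (vPrimeConc T U g.eta A blk kQ kF sQ sF cfun) * Gp)) (Qcs' ∘ₗ secRes rep) (secConj rep Tinv) (secExt rep ∘ₗ Qc')) * conj b (diffLetter T U ((g.eta : ℂ)⁻¹) l))
        (fun a a' => K * (g.len a)⁻¹ * Real.exp (-(1 / 5 * δ₀ * g.dist a a')))) ∧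
      (∀ k l : κ ⊕ κ, HasKernelBound (g := toB6 g Rr H) (fun p : S × ι => blk p.1) v cK (conj b (diffLetter T U ((g.eta : ℂ)⁻¹) k) * (B9Eq360Vprime.pOp (gPrimeExtEnd Gp (conj b (vPrimeConc T U g.eta A blk kQ kF sQ sF cfun) * Gp)) (Qcs' ∘ₗ secRes rep) (secConj rep Tinv) (secExt rep ∘ₗ Qc')) * conj b (diffLetter T U ((g.eta : ℂ)⁻¹) l))
        (fun a a' => K * (g.len a ^ 2)⁻¹ * Real.exp (-(1 / 5 * δ₀ * g.dist a a')))) := by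
  classical
  -- FILE 26: the block majorants of every `X·G′(U′U)`; FILE 29: the kernel entries of `G′(U′U)`; FILE 26: `C⁻¹(U′U)` with its (3.48) kernel bound
  obtain ⟨a₁, ha₁, B, hB, hGp⟩ := thm34_Gp_final (Rr := Rr) (H := H) b T U blk d δ₀ BG Cq a₀ d₀ M₂ kQ sQ cfun w hBG hCq ha₀ hM₂ hδ₀
    hdnn htri hrefl hsym hlen hlenη hη h261 hST hrepr hU1 hd₀B hd₀F hd₀0 hw hcard hkQ hsQ hcfun hΔpGp hGpΔp h342_1 h342_2 h342_3
  obtain ⟨a₂, ha₂, B', hB', hGpK⟩ := thm34_Gp_kernel_final (Rr := Rr) (H := H) b T U blk d δ₀ BG Cq a₀ d₀ M₂ kQ sQ cfun w hBG hCq ha₀ hM₂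
    hδ₀ hdnn htri hrefl hsym hlen hlenη hη h261 hST hrepr hU1 hd₀B hd₀F hd₀0 hw hcard hkQ hsQ hcfun hΔpGp hGpΔp h342_1 h342_2 h342_3 hv hcK
    hGpk hDGpk hGpDk hDGpDk
  obtain ⟨a₃, ha₃, hCi⟩ := thm34_Cinv_final (Rr := Rr) (H := H) b T U blk d δ₀ κQ BG B₁ cF Cq a₀ d₀ M₂ kQ sQ cfun w hκQ hBG hB₁ hcF hCq ha₀
    hM₂ hδ₀ hdnn htri hrefl hsym hlen hlenη hη h261 hST hrepr hU1 hd₀B hd₀F hd₀0 hw hcard hkQ hsQ hcfun h342_1 h342_2 hQc hQcs hLinv h348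
  -- the p. 398 scale transfers and [4] Lemma 2.1 at exponent `1/100`
  obtain ⟨Λ, hΛ1, hT1, hT2, -, -, hT4, -⟩ := hST (1 / 100) (by norm_num)
  have hΛ0 : 0 ≤ Λ := zero_le_one.trans hΛ1
  have h261β : Ineq261 d (toB6 g Rr H) δ₀ (1 / 100) := h261 _ (by norm_num) (by norm_num)
  have hc1 : 0 ≤ B6.c1 d δ₀ (1 / 100) := B6RandomWalk.c1_nonneg d δ₀ (1 / 100)
  have hc1' : 0 ≤ B6.c1 d (2 / 5 * δ₀) (1 / 10) := B6RandomWalk.c1_nonneg d (2 / 5 * δ₀) (1 / 10)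
  have hB₁' : 0 ≤ 2 * B₁ * B6.c1 d (2 / 5 * δ₀) (1 / 10) := mul_nonneg (mul_nonneg zero_le_two hB₁.le) hc1'
  have hκ' : 0 ≤ κQ + cF := add_nonneg hκQ.le hcF.le
  have hA₁ : 0 ≤ (κQ + cF) ^ 2 * B * (2 * B₁ * B6.c1 d (2 / 5 * δ₀) (1 / 10)) * 1 * Λ ^ 4 * B6.c1 d δ₀ (1 / 100) ^ 2 :=
    mul_nonneg (mul_nonneg (mul_nonneg (mul_nonneg (mul_nonneg (sq_nonneg _) hB) hB₁') zero_le_one) (pow_nonneg hΛ0 4)) (sq_nonneg _)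
  have hK : 0 ≤ (κQ + cF) ^ 2 * B * (2 * B₁ * B6.c1 d (2 / 5 * δ₀) (1 / 10)) * 1 * Λ ^ 4 * B6.c1 d δ₀ (1 / 100) ^ 2 * B' * Λ * B6.c1 d δ₀ (1 / 100) := mul_nonneg (mul_nonneg (mul_nonneg hA₁ hB') hΛ0) hc1
  refine ⟨min (min a₁ a₂) (min a₃ 1), lt_min (lt_min ha₁ ha₂) (lt_min ha₃ one_pos), (κQ + cF) ^ 2 * B * (2 * B₁ * B6.c1 d (2 / 5 * δ₀) (1 / 10)) * 1 * Λ ^ 4 * B6.c1 d δ₀ (1 / 100) ^ 2 * B' * Λ * B6.c1 d δ₀ (1 / 100), hK, ?_⟩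
  intro α₁ hα₁0 hα₁1 A kF sF hkF hsF h337B h337F h337Bτ hA hAτB Qc' Fc Qcs' Fcs h357 h357s hFc hFcs
  have hα₁a : α₁ ≤ a₁ := hα₁1.trans ((min_le_left _ _).trans (min_le_left _ _))
  have hα₁b : α₁ ≤ a₂ := hα₁1.trans ((min_le_left _ _).trans (min_le_right _ _))
  have hα₁c : α₁ ≤ a₃ := hα₁1.trans ((min_le_right _ _).trans (min_le_left _ _))
  have hα₁one : α₁ ≤ 1 := hα₁1.trans ((min_le_right _ _).trans (min_le_right _ _))
  obtain ⟨-, -, hL, -⟩ := hGp α₁ hα₁0 hα₁a A kF sF hkF hsF h337B h337F h337Bτ hA hAτB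
  obtain ⟨-, -, hKE, -, hKED, -⟩ := hGpK α₁ hα₁0 hα₁b A kF sF hkF hsF h337B h337F h337Bτ hA hAτB
  obtain ⟨Tinv, hTl, hTr, h348T⟩ := hCi α₁ hα₁0 hα₁c A kF sF hkF hsF h337B hA hAτB h357 h357s hFc hFcs
  refine ⟨Tinv, hTl, hTr, ?_⟩
  -- rate bookkeeping: letters at `9δ₀/25`, the prefix word at `δ₀/4`, the kernel at `δ₀/5`, exponents `1/100`
  have hρw : 1 / 4 * δ₀ + (2 * (1 / 100) + 1 / 100) * δ₀ ≤ 9 / 25 * δ₀ := by linarith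
  have hρw0 : 0 ≤ 1 / 4 * δ₀ := by linarith
  have hρk : 1 / 5 * δ₀ + (1 / 100 + 1 / 100) * δ₀ ≤ 1 / 4 * δ₀ := by linarith
  have hρk0 : 0 ≤ 1 / 5 * δ₀ := by linarith
  have h925 : 9 / 25 * δ₀ ≤ 9 / 10 * δ₀ := by linarith
  have h15 : 1 / 5 * δ₀ ≤ 4 / 5 * δ₀ := by linarith
  -- the identity letter `Y = 1` with the majorant `e^{−δd}` (`d(y,y) = 0`) and its trivial scale transfer
  have hY1 : HasMajorantHom (g := toB6 g Rr H) (fun p : S × ι => blk p.1) (fun p : S × ι => blk p.1) (1 : Module.End ℝ (S × ι → ℝ))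
      (fun a a' => (1 : ℝ) * (fun _ : g.Site => (1 : ℝ)) a * Real.exp (-(9 / 25 * δ₀ * g.dist a a'))) := by
    intro y' μ Bμ hμ x
    rw [Module.End.one_apply]
    dsimp only
    by_cases hx : blk x.1 = y'
    · rw [hx, hrefl, mul_zero, neg_zero, Real.exp_zero]
      simpa using hμ.bound x hx
    · rw [hμ.off x hx, abs_zero]
      exact mul_nonneg (by positivity) hμ.nonneg
  have hSTone : ScaleTransfer g δ₀ (1 / 100) Λ (fun _ : g.Site => (1 : ℝ)) := fun y y' => by
    simp only [mul_one]
    have h0 : 0 ≤ 1 / 100 * δ₀ * g.dist y y' := mul_nonneg (mul_nonneg (by norm_num) hδ₀.le) (hdnn y y')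
    exact (Real.exp_le_one_iff.mpr (by linarith)).trans hΛ1
  -- the (3.57) letters `Q′(U′U) = Q′ + F′₂`, `Q′*(U′U) = Q′* + F′₂*`: block-local of size `κ_Q + c_Fα₁ ≦ κ_Q + c_F` (`α₁ ≦ 1`)
  have hQc' : HasMajorantHom (g := toB6 g Rr H) (fun p : S × ι => blk p.1) (fun y : g.Site => y) Qc'
      (fun a a' : g.Site => if a = a' then κQ + cF else 0) := by
    rw [h357]
    refine hasMajorantHom_mono (g := toB6 g Rr H) _ _ (hasMajorantHom_add (g := toB6 g Rr H) _ _ hQc hFc) fun a a' => ?_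
    split_ifs with hab
    · have hc : cF * α₁ ≤ cF := mul_le_of_le_one_right hcF.le hα₁one
      linarith
    · simp
  have hQcs' : HasMajorantHom (g := toB6 g Rr H) (fun y : g.Site => y) (fun p : S × ι => blk p.1) Qcs'
      (fun a a' : g.Site => if a = a' then κQ + cF else 0) := by
    rw [h357s]
    refine hasMajorantHom_mono (g := toB6 g Rr H) _ _ (hasMajorantHom_add (g := toB6 g Rr H) _ _ hQcs hFcs) fun a a' => ?_
    split_ifs with hab
    · have hc : cF * α₁ ≤ cF := mul_le_of_le_one_right hcF.le hα₁one
      linarith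
    · simp
  -- `C⁻¹(U′U)`: the (3.48) kernel bound read as a block majorant on 𝔅 (identity block map)
  have hr4 : ∀ a : g.Site, g.len a ^ (-(4 : ℝ)) = (g.len a ^ 4)⁻¹ := fun a => by
    rw [Real.rpow_neg (hlen a).le, show (4 : ℝ) = ((4 : ℕ) : ℝ) by norm_num, Real.rpow_natCast]
  have hCinvM : HasMajorant (g := toB6 g Rr H) (fun y : g.Site => y) Tinv
      (fun a a' => 2 * B₁ * B6.c1 d (2 / 5 * δ₀) (1 / 10) * (g.len a ^ 4)⁻¹ * Real.exp (-(9 / 25 * δ₀ * g.dist a a'))) :=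
    hasMajorant_mono (g := toB6 g Rr H) _
      (hasMajorant_id_of_ker (R := Rr) (H := H) d hlen (2 * B₁ * B6.c1 d (2 / 5 * δ₀) (1 / 10)) (fun y => g.len y ^ (-(4 : ℝ)))
        (fun y y' => Real.exp (-(9 / 25 * δ₀ * g.dist y y'))) h348T) fun a a' => le_of_eq (by simp only [hr4])
  -- the left letters `X·G′(U′U)`, `X ∈ {1, ∇_k}`, as two-space majorants at the rate `9δ₀/25` (FILE 26)
  have hEm : HasMajorant (g := toB6 g Rr H) (fun p : S × ι => blk p.1) (gPrimeExtEnd Gp (conj b (vPrimeConc T U g.eta A blk kQ kF sQ sF cfun) * Gp))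
      (fun a a' => B * g.len a ^ 2 * Real.exp (-(9 / 10 * δ₀ * g.dist a a'))) := by
    simpa only [one_mul] using hL 1 (fun a => g.len a ^ 2) (fun a => sq_nonneg _) (by simpa only [one_mul] using h342_1)
  have hXE : HasMajorantHom (g := toB6 g Rr H) (fun p : S × ι => blk p.1) (fun p : S × ι => blk p.1) (gPrimeExtEnd Gp (conj b (vPrimeConc T U g.eta A blk kQ kF sQ sF cfun) * Gp))
      (fun a a' => B * g.len a ^ 2 * Real.exp (-(9 / 25 * δ₀ * g.dist a a'))) :=
    hasMajorantHom_rate_mono (R := Rr) (H := H) _ _ B (fun a => g.len a ^ 2) hB (fun a => sq_nonneg _) h925 hdnn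
      ((hasMajorantHom_iff (g := toB6 g Rr H) _ _ _).mpr hEm)
  have hXDE : ∀ k : κ ⊕ κ, HasMajorantHom (g := toB6 g Rr H) (fun p : S × ι => blk p.1) (fun p : S × ι => blk p.1) (conj b (diffLetter T U ((g.eta : ℂ)⁻¹) k) * gPrimeExtEnd Gp (conj b (vPrimeConc T U g.eta A blk kQ kF sQ sF cfun) * Gp))
      (fun a a' => B * g.len a * Real.exp (-(9 / 25 * δ₀ * g.dist a a'))) := fun k =>
    hasMajorantHom_rate_mono (R := Rr) (H := H) _ _ B (fun a => g.len a) hB (fun a => (hlen a).le) h925 hdnn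
      ((hasMajorantHom_iff (g := toB6 g Rr H) _ _ _).mpr (hL _ (fun a => g.len a) (fun a => (hlen a).le) (h342_2 k)))
  -- the right letters `G′(U′U)·Y`, `Y ∈ {1, ∇*_l}`, in KERNEL form at the rate `δ₀/5` (FILE 29)
  have hKE' : HasKernelBound (g := toB6 g Rr H) (fun p : S × ι => blk p.1) v cK (gPrimeExtEnd Gp (conj b (vPrimeConc T U g.eta A blk kQ kF sQ sF cfun) * Gp))
      (fun a a' => B' * g.len a ^ 2 * Real.exp (-(1 / 5 * δ₀ * g.dist a a'))) :=
    hasKernelBound_rate_mono (R := Rr) (H := H) _ hv cK B' (fun a => g.len a ^ 2) hB' (fun a => sq_nonneg _) h15 hdnn hKE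
  have hKED' : ∀ l : κ ⊕ κ, HasKernelBound (g := toB6 g Rr H) (fun p : S × ι => blk p.1) v cK (gPrimeExtEnd Gp (conj b (vPrimeConc T U g.eta A blk kQ kF sQ sF cfun) * Gp) * conj b (diffLetter T U ((g.eta : ℂ)⁻¹) l))
      (fun a a' => B' * g.len a * Real.exp (-(1 / 5 * δ₀ * g.dist a a'))) := fun l =>
    hasKernelBound_rate_mono (R := Rr) (H := H) _ hv cK B' (fun a => g.len a) hB' (fun a => (hlen a).le) h15 hdnn (hKED l)
  -- the prefix words `X·G′(U′U)·Q′*(U′U)·C⁻¹(U′U)·Q′(U′U)` (gen 11's two-space word calculus, `Y = 1`)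
  have hW1 := hasMajorantHom_word349 (R := Rr) (H := H) (fun p : S × ι => blk p.1) (fun p : S × ι => blk p.1)
    (fun p : S × ι => blk p.1) (fun y : g.Site => y) d δ₀ (9 / 25 * δ₀) (1 / 100) (1 / 100) (1 / 4 * δ₀) Λ (κQ + cF) B
    (2 * B₁ * B6.c1 d (2 / 5 * δ₀) (1 / 10)) 1 (fun a => g.len a ^ 2) (fun _ => (1 : ℝ)) (fun a => sq_nonneg _) (fun _ => zero_le_one)
    hκ' hB hB₁' zero_le_one hΛ1 hρw0 (by norm_num) (by norm_num) hδ₀.le hρw hdnn htri h261β hSTone hT4 hXE hY1 hQc' hQcs' hCinvM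
  have hW2 := fun k : κ ⊕ κ => hasMajorantHom_word349 (R := Rr) (H := H) (fun p : S × ι => blk p.1) (fun p : S × ι => blk p.1)
    (fun p : S × ι => blk p.1) (fun y : g.Site => y) d δ₀ (9 / 25 * δ₀) (1 / 100) (1 / 100) (1 / 4 * δ₀) Λ (κQ + cF) B
    (2 * B₁ * B6.c1 d (2 / 5 * δ₀) (1 / 10)) 1 (fun a => g.len a) (fun _ => (1 : ℝ)) (fun a => (hlen a).le) (fun _ => zero_le_one)
    hκ' hB hB₁' zero_le_one hΛ1 hρw0 (by norm_num) (by norm_num) hδ₀.le hρw hdnn htri h261β hSTone hT4 (hXDE k) hY1 hQc' hQcs' hCinvM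
  -- weight bookkeeping and the section identity
  have i11 : ∀ a : g.Site, g.len a ^ 2 * ((g.len a ^ 4)⁻¹ * 1) * g.len a ^ 2 = 1 := fun a => by
    have hℓ : g.len a ≠ 0 := (hlen a).ne'
    field_simp
  have i21 : ∀ a : g.Site, g.len a * ((g.len a ^ 4)⁻¹ * 1) * g.len a ^ 2 = (g.len a)⁻¹ := fun a => by
    have hℓ : g.len a ≠ 0 := (hlen a).ne'
    field_simp
  have i12 : ∀ a : g.Site, g.len a ^ 2 * ((g.len a ^ 4)⁻¹ * 1) * g.len a = (g.len a)⁻¹ := fun a => by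
    have hℓ : g.len a ≠ 0 := (hlen a).ne'
    field_simp
  have i22 : ∀ a : g.Site, g.len a * ((g.len a ^ 4)⁻¹ * 1) * g.len a = (g.len a ^ 2)⁻¹ := fun a => by
    have hℓ : g.len a ≠ 0 := (hlen a).ne'
    field_simp
  have hinj : Function.Injective rep := fun y₁ y₂ h => by rw [← hrep y₁, ← hrep y₂, h]
  have hw₁ : ∀ a : g.Site, 0 ≤ g.len a ^ 2 * ((g.len a ^ 4)⁻¹ * 1) := fun a => by positivity
  have hw₁' : ∀ a : g.Site, 0 ≤ g.len a * ((g.len a ^ 4)⁻¹ * 1) := fun a =>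
    mul_nonneg (hlen a).le (mul_nonneg (inv_nonneg.mpr (by positivity)) zero_le_one)
  refine ⟨?_, fun k => ?_, fun l => ?_, fun k l => ?_⟩
  · -- (3.49)₁: `P(U′U) = (G′Q′*C⁻¹Q′)(U′U) · G′(U′U)`
    have hc := hasKernelBound_comp_decay (R := Rr) (H := H) (fun p : S × ι => blk p.1) d δ₀ (1 / 100) (1 / 100) (1 / 5 * δ₀) (1 / 4 * δ₀) Λ
      ((κQ + cF) ^ 2 * B * (2 * B₁ * B6.c1 d (2 / 5 * δ₀) (1 / 10)) * 1 * Λ ^ 4 * B6.c1 d δ₀ (1 / 100) ^ 2) B'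
      (fun a => g.len a ^ 2 * ((g.len a ^ 4)⁻¹ * 1)) (fun a => g.len a ^ 2) hw₁ (fun a => sq_nonneg _) hΛ0 hA₁ hB' hρk0 hρk hdnn htri hT2
      h261β hv hcK ((hasMajorantHom_iff (g := toB6 g Rr H) _ _ _).mp hW1) hKE'
    have hop : B9Eq360Vprime.pOp (gPrimeExtEnd Gp (conj b (vPrimeConc T U g.eta A blk kQ kF sQ sF cfun) * Gp)) (Qcs' ∘ₗ secRes rep) (secConj rep Tinv) (secExt rep ∘ₗ Qc') = ((gPrimeExtEnd Gp (conj b (vPrimeConc T U g.eta A blk kQ kF sQ sF cfun) * Gp)) ∘ₗ Qcs' ∘ₗ Tinv ∘ₗ Qc' ∘ₗ (1 : Module.End ℝ (S × ι → ℝ))) * (gPrimeExtEnd Gp (conj b (vPrimeConc T U g.eta A blk kQ kF sQ sF cfun) * Gp)) :=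
      LinearMap.ext fun F => by
        simp only [B9Eq360Vprime.pOp, Module.End.mul_apply, LinearMap.comp_apply, Module.End.one_apply, secConj_def,
          secRes_secExt_apply hinj]
    rw [hop]
    refine hasKernelBound_mono (g := toB6 g Rr H) _ hv hc fun a a' => le_of_eq ?_
    rw [i11 a]
    ring
  · -- (3.49)₂: `∇_kP(U′U)`
    have hc := hasKernelBound_comp_decay (R := Rr) (H := H) (fun p : S × ι => blk p.1) d δ₀ (1 / 100) (1 / 100) (1 / 5 * δ₀) (1 / 4 * δ₀) Λ
      ((κQ + cF) ^ 2 * B * (2 * B₁ * B6.c1 d (2 / 5 * δ₀) (1 / 10)) * 1 * Λ ^ 4 * B6.c1 d δ₀ (1 / 100) ^ 2) B'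
      (fun a => g.len a * ((g.len a ^ 4)⁻¹ * 1)) (fun a => g.len a ^ 2) hw₁' (fun a => sq_nonneg _) hΛ0 hA₁ hB' hρk0 hρk hdnn htri hT2
      h261β hv hcK ((hasMajorantHom_iff (g := toB6 g Rr H) _ _ _).mp (hW2 k)) hKE'
    have hop : conj b (diffLetter T U ((g.eta : ℂ)⁻¹) k) * (B9Eq360Vprime.pOp (gPrimeExtEnd Gp (conj b (vPrimeConc T U g.eta A blk kQ kF sQ sF cfun) * Gp)) (Qcs' ∘ₗ secRes rep) (secConj rep Tinv) (secExt rep ∘ₗ Qc')) = ((conj b (diffLetter T U ((g.eta : ℂ)⁻¹) k) * (gPrimeExtEnd Gp (conj b (vPrimeConc T U g.eta A blk kQ kF sQ sF cfun) * Gp))) ∘ₗ Qcs' ∘ₗ Tinv ∘ₗ Qc' ∘ₗ (1 : Module.End ℝ (S × ι → ℝ))) * (gPrimeExtEnd Gp (conj b (vPrimeConc T U g.eta A blk kQ kF sQ sF cfun) * Gp)) :=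
      LinearMap.ext fun F => by
        simp only [B9Eq360Vprime.pOp, Module.End.mul_apply, LinearMap.comp_apply, Module.End.one_apply, secConj_def,
          secRes_secExt_apply hinj]
    rw [hop]
    refine hasKernelBound_mono (g := toB6 g Rr H) _ hv hc fun a a' => le_of_eq ?_
    rw [i21 a]
  · -- (3.49)₃: `P(U′U)∇*_l`
    have hc := hasKernelBound_comp_decay (R := Rr) (H := H) (fun p : S × ι => blk p.1) d δ₀ (1 / 100) (1 / 100) (1 / 5 * δ₀) (1 / 4 * δ₀) Λ
      ((κQ + cF) ^ 2 * B * (2 * B₁ * B6.c1 d (2 / 5 * δ₀) (1 / 10)) * 1 * Λ ^ 4 * B6.c1 d δ₀ (1 / 100) ^ 2) B'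
      (fun a => g.len a ^ 2 * ((g.len a ^ 4)⁻¹ * 1)) (fun a => g.len a) hw₁ (fun a => (hlen a).le) hΛ0 hA₁ hB' hρk0 hρk hdnn htri hT1
      h261β hv hcK ((hasMajorantHom_iff (g := toB6 g Rr H) _ _ _).mp hW1) (hKED' l)
    have hop : (B9Eq360Vprime.pOp (gPrimeExtEnd Gp (conj b (vPrimeConc T U g.eta A blk kQ kF sQ sF cfun) * Gp)) (Qcs' ∘ₗ secRes rep) (secConj rep Tinv) (secExt rep ∘ₗ Qc')) * conj b (diffLetter T U ((g.eta : ℂ)⁻¹) l) = ((gPrimeExtEnd Gp (conj b (vPrimeConc T U g.eta A blk kQ kF sQ sF cfun) * Gp)) ∘ₗ Qcs' ∘ₗ Tinv ∘ₗ Qc' ∘ₗ (1 : Module.End ℝ (S × ι → ℝ))) * ((gPrimeExtEnd Gp (conj b (vPrimeConc T U g.eta A blk kQ kF sQ sF cfun) * Gp)) * conj b (diffLetter T U ((g.eta : ℂ)⁻¹) l)) :=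
      LinearMap.ext fun F => by
        simp only [B9Eq360Vprime.pOp, Module.End.mul_apply, LinearMap.comp_apply, Module.End.one_apply, secConj_def,
          secRes_secExt_apply hinj]
    rw [hop]
    refine hasKernelBound_mono (g := toB6 g Rr H) _ hv hc fun a a' => le_of_eq ?_
    rw [i12 a]
  · -- (3.49)₄: `∇_kP(U′U)∇*_l`
    have hc := hasKernelBound_comp_decay (R := Rr) (H := H) (fun p : S × ι => blk p.1) d δ₀ (1 / 100) (1 / 100) (1 / 5 * δ₀) (1 / 4 * δ₀) Λ
      ((κQ + cF) ^ 2 * B * (2 * B₁ * B6.c1 d (2 / 5 * δ₀) (1 / 10)) * 1 * Λ ^ 4 * B6.c1 d δ₀ (1 / 100) ^ 2) B'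
      (fun a => g.len a * ((g.len a ^ 4)⁻¹ * 1)) (fun a => g.len a) hw₁' (fun a => (hlen a).le) hΛ0 hA₁ hB' hρk0 hρk hdnn htri hT1
      h261β hv hcK ((hasMajorantHom_iff (g := toB6 g Rr H) _ _ _).mp (hW2 k)) (hKED' l)
    have hop : conj b (diffLetter T U ((g.eta : ℂ)⁻¹) k) * (B9Eq360Vprime.pOp (gPrimeExtEnd Gp (conj b (vPrimeConc T U g.eta A blk kQ kF sQ sF cfun) * Gp)) (Qcs' ∘ₗ secRes rep) (secConj rep Tinv) (secExt rep ∘ₗ Qc')) * conj b (diffLetter T U ((g.eta : ℂ)⁻¹) l) = ((conj b (diffLetter T U ((g.eta : ℂ)⁻¹) k) * (gPrimeExtEnd Gp (conj b (vPrimeConc T U g.eta A blk kQ kF sQ sF cfun) * Gp))) ∘ₗ Qcs' ∘ₗ Tinv ∘ₗ Qc' ∘ₗ (1 : Module.End ℝ (S × ι → ℝ))) * ((gPrimeExtEnd Gp (conj b (vPrimeConc T U g.eta A blk kQ kF sQ sF cfun) * Gp)) * conj b (diffLetter T U ((g.eta : ℂ)⁻¹) l)) :=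
      LinearMap.ext fun F => by
        simp only [B9Eq360Vprime.pOp, Module.End.mul_apply, LinearMap.comp_apply, Module.End.one_apply, secConj_def,
          secRes_secExt_apply hinj]
    rw [hop]
    refine hasKernelBound_mono (g := toB6 g Rr H) _ hv hc fun a a' => le_of_eq ?_
    rw [i22 a]


end Final

end Literature.MathematicalPhysics.QuantumFieldTheory.Balaban1983to89.B9Thm34PKernelFinal

end
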